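import Literature.AlgebraicGeometry.HodgeTheory.SupportedClassesOfChowZeroSupportedAboveDim
import HarnessLib

/-!
# A correspondence with a Bloch–Srinivas decomposition acts into geometric coniveau `≥ 1` above the dimension of its second support

Family `hodge`, layer `Literature/AlgebraicGeometry/HodgeTheory` (theorems only; no definition, no
named fact). The CORRESPONDENCE form of the sibling theorem
`GysinFormalism.supportedClasses_eq_top_of_chowZeroSupportedInDimLE_of_lt`
(`SupportedClassesOfChowZeroSupportedAboveDim`: `CH₀(X)` supported in dimension `≤ d` ⟹
`N¹Hˡ(X) = Hˡ(X)` for `l > d`, through the decomposition of the DIAGONAL). S. Bloch and V. Srinivas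
prove their decomposition for an arbitrary correspondence (Amer. J. Math. 105 (1983), Prop. 1;
C. Voisin, *Hodge Theory and Complex Algebraic Geometry II* (2003), Thm. 10.19 and Cor. 10.20: a
codimension-`n` cycle `Z ⊂ X × X` whose `0`-cycles `Z_*(x)` are all rationally equivalent to cycles
supported on a closed `X' ⊆ X` satisfies `mZ = Z' + Z''` in `CHⁿ(X × X)` with `Z'` supported in
`T × X`, `T ⊊ X` proper closed, and `Z''` supported in `X × X'`), and the cohomological mechanism of
the proof of Voisin II Thm. 10.17 ((10.5)–(10.10)) then applies verbatim to `[Z]^*` in place of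
`[Δ_X]^* = Id`. This file records that mechanism for a GIVEN decomposition (the cycle-theoretic
input being the hypothesis), on the tree's real carriers and for an arbitrary Gysin / cycle-class
formalism `G` (`HodgeTheory.GysinFormalism`, `G.corrAct` = the action `[Z]^*` of Voisin II (10.7)):

* `GysinFormalism.corrAct_mem_supportedClasses_one_of_decomposition` — **for `X` smooth projective
  of dimension `n`, an `n`-cycle `Γ` on `X ⊗ X` with `m • Γ ∼_rat Z' + Z''` (`m > 0`), `Z'` supported
  in `T × X` for a closed `T ⊊ X` and `Z''` supported in `X × W` for a `W` all of whose points have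
  dimension `≤ d`, and every `l > d`: `[Γ]^* c ∈ N¹Hˡ(X(ℂ); ℂ)` for every `c ∈ Hˡ(X(ℂ); ℂ)`**
  (`m [Γ]^*c = [Z']^*c + [Z'']^*c` by Lemma 9.18 = `G.corrAct_congr`; `[Z']^*c` dies off `T`, (10.8);
  every component of `Z''` lies over a point of `W`, of dimension `< l`, so `[Z'']^*c ∈ N¹` by
  Andreotti–Frankel on a resolution, the sibling file's
  `GysinFormalism.corrAct_primeCycle_mem_supportedClasses_one_of_height_snd_lt`; `m` is invertible in
  `ℂ`); range form `GysinFormalism.range_corrAct_le_supportedClasses_one_of_decomposition`.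
* `GysinFormalism.le_supportedClasses_one_of_le_range_corrAct_of_decomposition` — hence every
  subspace of `Hˡ(X(ℂ); ℂ)` contained in the image of such a `[Γ]^*` (e.g. one on which `[Γ]^*`
  acts invertibly: a sub-Hodge structure cut out by a projector with such a decomposition) lies in
  `N¹Hˡ(X)`; threefold case `…three_one…` (the projector form of the known regime of Grothendieck's
  amended GHC(3,1): the case `Γ = Δ_X` is the sibling theorem
  `supportedClasses_three_one_eq_top_of_hasChowZeroSupportedInDimLE_two`).

TODO(general form): the cycle-theoretic input — Voisin II Thm. 10.19 / Bloch–Srinivas Prop. 1 for an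
arbitrary correspondence `Γ` whose `0`-cycles are universally rationally equivalent to cycles
supported on `W` — is proved in the tree only for `Γ = Δ_X`
(`Barriers.HodgeConjecture.BlochSrinivas1983_decompositionOfTheDiagonal_holds`); the general case is
the natural named fact to file next to it.

## References

* [BlochSrinivas1983] S. Bloch, V. Srinivas, Remarks on correspondences and algebraic cycles,
  Amer. J. Math. 105 (1983) 1235–1253, Prop. 1 and Thm. 1 (proof).
* [VoisinHodgeII2003] C. Voisin, Hodge Theory and Complex Algebraic Geometry II (2003), Thm. 10.19,
  Cor. 10.20, proof of Thm. 10.17 ((10.5)–(10.10)), Lemma 9.18, and §1.2.2 Thm. 1.22.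
* [GrothendieckTopology1969] A. Grothendieck, Hodge's general conjecture is false for trivial
  reasons, Topology 8 (1969), §1 (the coniveau filtration `Nᵖ`).
-/

noncomputable section

open CategoryTheory CategoryTheory.Limits AlgebraicGeometry MonoidalCategory CartesianMonoidalCategory

namespace Literature.AlgebraicGeometry.HodgeTheory

open Literature.AlgebraicGeometry.Motives Literature.Barriers.HodgeConjecture
open Literature.AlgebraicTopology.SingularHomology

section HodgeTheory

variable {n : ℕ} {X : SchemeOver ℂ}

/-- **A correspondence with a Bloch–Srinivas decomposition acts into `N¹` above the dimension of
its second support.** Let `X` be smooth projective of dimension `n`, `Γ, Z', Z''` be `n`-cycles on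
`X ⊗ X` with `m • Γ ∼_rat Z' + Z''` for some `m > 0`, `Z'` supported in `T × X` for a Zariski-closed
`T ⊊ X`, and `Z''` supported in `X × W` where every point of `W` has dimension `≤ d`
(`Order.height ≤ d`). Then for every `l > d` and every `c ∈ Hˡ(X(ℂ); ℂ)`,
`[Γ]^* c ∈ N¹Hˡ(X(ℂ); ℂ)`: `m [Γ]^*c = [Z']^*c + [Z'']^*c` (Lemma 9.18), `[Z']^*c` is supported on
`T` ((10.8)) and `[Z'']^*c ∈ N¹` component by component ((10.9) in coniveau form, Andreotti–Frankel).
The case `Γ = Δ_X` (`[Δ_X]^* = Id`) is `GysinFormalism.supportedClasses_eq_top_of_chowZeroSupportedInDimLE_of_lt`.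
[cite: BlochSrinivas1983, Prop. 1 and Thm. 1 (proof)]
[cite: VoisinHodgeII2003, Thm. 10.19, Cor. 10.20 and proof of Thm. 10.17 ((10.5)–(10.10))] -/
theorem GysinFormalism.corrAct_mem_supportedClasses_one_of_decomposition (G : GysinFormalism)
    (hX : IsSmoothProjective n X) (Γ Z' Z'' : ↥(cyclesOfDim (X ⊗ X).left n)) {m : ℕ} (hm : 0 < m)
    {T : Set X.left} (hT : IsClosed T) (hTne : T ≠ Set.univ)
    (hZ'T : ∀ z, (Z' : AlgebraicCycle (X ⊗ X).left ℤ) z ≠ 0 → (fst X X).left.base z ∈ T)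
    {W : Set X.left} {d : ℕ} (hWd : ∀ w ∈ W, Order.height w ≤ d)
    (hZ''W : ∀ z, (Z'' : AlgebraicCycle (X ⊗ X).left ℤ) z ≠ 0 → (snd X X).left.base z ∈ W)
    (hrat : IsRationallyEquivalent
      ((m • Γ : ↥(cyclesOfDim (X ⊗ X).left n)) : AlgebraicCycle (X ⊗ X).left ℤ)
      ((Z' + Z'' : ↥(cyclesOfDim (X ⊗ X).left n)) : AlgebraicCycle (X ⊗ X).left ℤ) n)
    {l : ℕ} (hdl : d < l) (c : complexBetti X l) :
    G.corrAct hX hX l Γ c ∈ supportedClasses X l 1 := by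
  classical
  -- (10.5) for `Γ`: `m • [Γ]^* = [Z']^* + [Z'']^*` (Lemma 9.18: the action factors through `CHⁿ`)
  have hact := G.corrAct_congr hX hX l hrat
  rw [map_nsmul, map_add] at hact
  have hmc : (m : ℂ) • G.corrAct hX hX l Γ c = G.corrAct hX hX l Z' c + G.corrAct hX hX l Z'' c := by
    have h := LinearMap.congr_fun hact c
    simp only [LinearMap.smul_apply, LinearMap.add_apply] at h
    rw [← h, Nat.cast_smul_eq_nsmul ℂ m]
  have hmem : (m : ℂ) • G.corrAct hX hX l Γ c ∈ supportedClasses X l 1 := by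
    rw [hmc]
    refine add_mem ?_ ?_
    · -- (10.8): `[Z']^*c` is supported on `T ⊊ X`
      exact G.corrAct_mem_supportedClasses_of_fst_mem hX l hT
        (one_le_coheight_of_isClosed_of_ne_univ hX hT hTne) hZ'T c
    · -- (10.9), coniveau form: `[Z'']^*c ∈ N¹`, component by component
      refine G.corrAct_mem_of_primeCycle hX hX l _ Z'' c fun z hz0 hz ↦ ?_
      have hd : Order.height ((snd X X).left.base z) ≤ (d : ℕ∞) := hWd _ (hZ''W z hz0)
      exact G.corrAct_primeCycle_mem_supportedClasses_one_of_height_snd_lt hX z hz (Z''.2 z hz0)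
        (lt_of_le_of_lt hd (by exact_mod_cast hdl)) c
  have hm0 : (m : ℂ) ≠ 0 := by exact_mod_cast hm.ne'
  rwa [Submodule.smul_mem_iff _ hm0] at hmem

/-- Range form: under a Bloch–Srinivas decomposition of `Γ` over `(T, W)` with `dim W ≤ d < l`, the
image of `[Γ]^* : Hˡ(X(ℂ); ℂ) → Hˡ(X(ℂ); ℂ)` lies in `N¹Hˡ(X(ℂ); ℂ)`.
[cite: BlochSrinivas1983, Prop. 1 and Thm. 1 (proof)] [cite: VoisinHodgeII2003, Thm. 10.19 and proof of Thm. 10.17] -/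
theorem GysinFormalism.range_corrAct_le_supportedClasses_one_of_decomposition (G : GysinFormalism)
    (hX : IsSmoothProjective n X) (Γ Z' Z'' : ↥(cyclesOfDim (X ⊗ X).left n)) {m : ℕ} (hm : 0 < m)
    {T : Set X.left} (hT : IsClosed T) (hTne : T ≠ Set.univ)
    (hZ'T : ∀ z, (Z' : AlgebraicCycle (X ⊗ X).left ℤ) z ≠ 0 → (fst X X).left.base z ∈ T)
    {W : Set X.left} {d : ℕ} (hWd : ∀ w ∈ W, Order.height w ≤ d)
    (hZ''W : ∀ z, (Z'' : AlgebraicCycle (X ⊗ X).left ℤ) z ≠ 0 → (snd X X).left.base z ∈ W)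
    (hrat : IsRationallyEquivalent
      ((m • Γ : ↥(cyclesOfDim (X ⊗ X).left n)) : AlgebraicCycle (X ⊗ X).left ℤ)
      ((Z' + Z'' : ↥(cyclesOfDim (X ⊗ X).left n)) : AlgebraicCycle (X ⊗ X).left ℤ) n)
    {l : ℕ} (hdl : d < l) :
    LinearMap.range (G.corrAct hX hX l Γ) ≤ supportedClasses X l 1 := by
  rintro _ ⟨c, rfl⟩
  exact G.corrAct_mem_supportedClasses_one_of_decomposition hX Γ Z' Z'' hm hT hTne hZ'T hWd hZ''W
    hrat hdl c

/-- **Subspaces inside the image of a decomposable correspondence are supported on a divisor**: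
with the decomposition of `Γ` over `(T, W)`, `dim W ≤ d < l`, every `V ≤ Hˡ(X(ℂ); ℂ)` contained in
the image of `[Γ]^*` — e.g. a subspace on which `[Γ]^*` restricts to a surjection onto itself, such
as a sub-Hodge structure cut out by a projector admitting such a decomposition — lies in
`N¹Hˡ(X(ℂ); ℂ)`. [cite: VoisinHodgeII2003, Thm. 10.19 and proof of Thm. 10.17]
[cite: GrothendieckTopology1969, §1] -/
theorem GysinFormalism.le_supportedClasses_one_of_le_range_corrAct_of_decomposition
    (G : GysinFormalism) (hX : IsSmoothProjective n X) (Γ Z' Z'' : ↥(cyclesOfDim (X ⊗ X).left n))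
    {m : ℕ} (hm : 0 < m) {T : Set X.left} (hT : IsClosed T) (hTne : T ≠ Set.univ)
    (hZ'T : ∀ z, (Z' : AlgebraicCycle (X ⊗ X).left ℤ) z ≠ 0 → (fst X X).left.base z ∈ T)
    {W : Set X.left} {d : ℕ} (hWd : ∀ w ∈ W, Order.height w ≤ d)
    (hZ''W : ∀ z, (Z'' : AlgebraicCycle (X ⊗ X).left ℤ) z ≠ 0 → (snd X X).left.base z ∈ W)
    (hrat : IsRationallyEquivalent
      ((m • Γ : ↥(cyclesOfDim (X ⊗ X).left n)) : AlgebraicCycle (X ⊗ X).left ℤ)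
      ((Z' + Z'' : ↥(cyclesOfDim (X ⊗ X).left n)) : AlgebraicCycle (X ⊗ X).left ℤ) n)
    {l : ℕ} (hdl : d < l) {V : Submodule ℂ (complexBetti X l)}
    (hV : V ≤ LinearMap.range (G.corrAct hX hX l Γ)) :
    V ≤ supportedClasses X l 1 :=
  hV.trans (G.range_corrAct_le_supportedClasses_one_of_decomposition hX Γ Z' Z'' hm hT hTne hZ'T hWd
    hZ''W hrat hdl)

/-- **Threefold case — the projector form of the known regime of Grothendieck's amended GHC(3,1).**
For `Y` smooth projective of dimension `3` and a self-correspondence `Γ ∈ Z₃(Y ⊗ Y)` with a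
Bloch–Srinivas decomposition `m • Γ ∼_rat Z' + Z''`, `Z'` over a proper closed `T ⊊ Y`, `Z''` over a
set `W` of points of dimension `≤ 2` (a surface): `[Γ]^*H³(Y(ℂ); ℂ) ⊆ N¹H³(Y)`, so every subspace of
`H³` inside the image of `[Γ]^*` — in particular every rational level-one sub-Hodge structure
preserved onto itself by `[Γ]^*` — is supported on a divisor. (`Γ = Δ_Y`: threefolds with `CH₀`
on a surface, `supportedClasses_three_one_eq_top_of_hasChowZeroSupportedInDimLE_two`.)
[cite: BlochSrinivas1983, Prop. 1 and Thm. 1 (proof)] [cite: VoisinHodgeII2003, Thm. 10.19 and proof of Thm. 10.17]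
[cite: GrothendieckTopology1969, §1 and p. 301] -/
theorem GysinFormalism.range_corrAct_le_supportedClasses_three_one_of_decomposition
    (G : GysinFormalism) {Y : SchemeOver ℂ} (hY : IsSmoothProjective 3 Y)
    (Γ Z' Z'' : ↥(cyclesOfDim (Y ⊗ Y).left 3)) {m : ℕ} (hm : 0 < m)
    {T : Set Y.left} (hT : IsClosed T) (hTne : T ≠ Set.univ)
    (hZ'T : ∀ z, (Z' : AlgebraicCycle (Y ⊗ Y).left ℤ) z ≠ 0 → (fst Y Y).left.base z ∈ T)
    {W : Set Y.left} (hW2 : ∀ w ∈ W, Order.height w ≤ 2)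
    (hZ''W : ∀ z, (Z'' : AlgebraicCycle (Y ⊗ Y).left ℤ) z ≠ 0 → (snd Y Y).left.base z ∈ W)
    (hrat : IsRationallyEquivalent
      ((m • Γ : ↥(cyclesOfDim (Y ⊗ Y).left 3)) : AlgebraicCycle (Y ⊗ Y).left ℤ)
      ((Z' + Z'' : ↥(cyclesOfDim (Y ⊗ Y).left 3)) : AlgebraicCycle (Y ⊗ Y).left ℤ) 3) :
    LinearMap.range (G.corrAct hY hY 3 Γ) ≤ supportedClasses Y 3 1 :=
  G.range_corrAct_le_supportedClasses_one_of_decomposition hY Γ Z' Z'' hm hT hTne hZ'T hW2 hZ''W hrat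
    (by norm_num)

end HodgeTheory

end Literature.AlgebraicGeometry.HodgeTheory

end
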